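import Summits.AtomisticToContinuum.FouriersLaw.Theses.BondHeatUncertainty
import Summits.AtomisticToContinuum.FouriersLaw.Theorems.BondHeatUncertaintySubdiffusiveBondHeatBathBondReductionFlowLaws
import Literature.MathematicalPhysics.KineticTheory.LangevinChainConfined

/-!
# `SubdiffusiveBondHeat` / bath-bond reduction, part 6: kernel pairings, Dynkin's identity integrated, statics

Helper file for crux `stmt-AtomisticToContinuum-9120` (`BondHeatUncertainty.SubdiffusiveBondHeat`), line
`bath-bond-deficit-integral`, stub `stub_bathBondReduction`. The martingale part `M_t = e₀(z_t) - e₀(z_0) - ∫₀ᵗ (Le₀)(z_s) ds`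
of the bath-site energy has `E M_t² = -2t ⟨Le₀, e₀⟩_{μ_T}` by a purely kernel-level computation, whose analytic
input is DYNKIN'S IDENTITY for the (polynomially growing, not compactly supported) observable `e₀` — in the tree
only for `C_c^∞` (`pinnedChain_dynkin`); here it enters as a hypothesis and is integrated against `L²` observables:

* `pinnedChain_integrable_mul_act_of_invariant` — for `f, h ∈ L²(μ)`, `μ` invariant: `f · (P_u h) ∈ L¹(μ)` with
  `∫ |f · P_u h| ≤ ∫ f² + ∫ h²` (through `μ ⊗ₘ P_u`);
* `pinnedChain_integral_mul_act_sub_of_dynkin` — pointwise Dynkin for `e` with `Le = ℓ` implies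
  `∫ f · (P_r e) dμ - ∫ f e dμ = ∫₀ʳ ∫ f · (P_s ℓ) dμ ds` (registered sub-goal `pinnedChain_dynkinIntegrated`);
* `pinnedChain_measurable_kernelPairing`, `pinnedChain_abs_kernelPairing_le`,
  `pinnedChain_intervalIntegrable_kernelPairing` — `u ↦ ∫ f · (P_{u⁺} h) dμ` is measurable and bounded;
* statics under the Gibbs measure `μ_T` of the pinned chain (`ω₂ > 0`, `lam, β ≥ 0`, `T > 0`):
  `(1 + H)⁴ ∈ L¹(μ_T)` (from `e^{ϑH} ∈ L¹(μ_T)`), hence square-integrability of the bond currents, of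
  `γ'(T' - p_i²)` and of the bath-site energy `e₀` (`pinnedChain_integrable_sq_*`).

Nothing here closes an item.
-/

noncomputable section

open MeasureTheory ProbabilityTheory Filter Topology Set intervalIntegral
open scoped NNReal ENNReal
open Literature.MathematicalPhysics.KineticTheory.HeatConduction Literature.Probability.Process

namespace Summit.AtomisticToContinuum.FouriersLaw.Theorems.SubdiffusiveBondHeat

open OscillatorChain

/-! ### Kernel pairings `∫ f · (P_u h) dμ` under an invariant law: integrability and bounds -/

section Pairing

variable {ω₂ lam β γ : ℝ} (hω : 0 < ω₂) (hl : 0 ≤ lam) (hβ : 0 ≤ β) (hγ : 0 ≤ γ) (N : ℕ) (T_L T_R : ℝ)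
include hω hl hβ hγ

/-- For `f, h ∈ L²(μ)` and `μ` invariant at time `u`: `y ↦ f(y) (P_u h)(y)` is `μ`-integrable and
`∫ |f| · |P_u h| dμ ≤ ∫ f² dμ + ∫ h² dμ`. [folklore] -/
theorem pinnedChain_integrable_mul_act_of_invariant (μ : Measure (PhaseSpace N)) [SFinite μ] (u : ℝ≥0)
    (hinv : μ.bind ((pinnedChain ω₂ lam β γ).transitionKernel N T_L T_R u) = μ)
    {f h : PhaseSpace N → ℝ} (hf : Measurable f) (hh : Measurable h)
    (hf2 : Integrable (fun y => f y ^ 2) μ) (hh2 : Integrable (fun y => h y ^ 2) μ) :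
    Integrable (fun y => f y * ∫ y', h y' ∂((pinnedChain ω₂ lam β γ).transitionKernel N T_L T_R u y)) μ ∧
    ∫ y, ‖f y * ∫ y', h y' ∂((pinnedChain ω₂ lam β γ).transitionKernel N T_L T_R u y)‖ ∂μ ≤
      (∫ y, f y ^ 2 ∂μ) + ∫ y, h y ^ 2 ∂μ := by
  set κ := (pinnedChain ω₂ lam β γ).transitionKernel N T_L T_R u with hκ
  haveI : IsMarkovKernel κ := pinnedChain_isMarkovKernel_transitionKernel hω hl hβ hγ N T_L T_R u
  have hce := pinnedChain_integrable_mul_compProd_of_invariant hω hl hβ hγ N T_L T_R μ u hinv hf hh hf2 hh2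
  have h2 : Integrable (fun y => ∫ y', ‖f y * h y'‖ ∂κ y) μ :=
    ((Measure.integrable_compProd_iff hce.aestronglyMeasurable).1 hce).2
  -- measurability of the pairing integrand
  have hPh : StronglyMeasurable fun y => ∫ y', h y' ∂κ y :=
    StronglyMeasurable.integral_kernel_prod_right' (κ := κ) (hh.comp measurable_snd).stronglyMeasurable
  have hm : AEStronglyMeasurable (fun y => f y * ∫ y', h y' ∂κ y) μ :=
    (hf.aestronglyMeasurable.mul hPh.aestronglyMeasurable)
  have hptw : ∀ y, ‖f y * ∫ y', h y' ∂κ y‖ ≤ ∫ y', ‖f y * h y'‖ ∂κ y := by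
    intro y
    rw [norm_mul]
    have h1 : ∫ y', ‖f y * h y'‖ ∂κ y = ‖f y‖ * ∫ y', ‖h y'‖ ∂κ y := by
      simp_rw [norm_mul]
      exact MeasureTheory.integral_const_mul _ _
    rw [h1]
    exact mul_le_mul_of_nonneg_left (MeasureTheory.norm_integral_le_integral_norm _) (norm_nonneg _)
  have hint : Integrable (fun y => f y * ∫ y', h y' ∂κ y) μ := h2.mono' hm (Eventually.of_forall hptw)
  refine ⟨hint, ?_⟩
  -- the bound through the composition-product
  have hfst : (μ ⊗ₘ κ).map Prod.fst = μ := Measure.fst_compProd μ κ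
  have hsnd : (μ ⊗ₘ κ).map Prod.snd = μ := by
    have h := Measure.snd_compProd μ κ
    rw [hinv] at h
    exact h
  have hA : Integrable (fun q : PhaseSpace N × PhaseSpace N => f q.1 ^ 2) (μ ⊗ₘ κ) := by
    have hf2' : Integrable (fun y => f y ^ 2) ((μ ⊗ₘ κ).map Prod.fst) := by rw [hfst]; exact hf2
    exact (integrable_map_measure hf2'.aestronglyMeasurable measurable_fst.aemeasurable).1 hf2'
  have hB : Integrable (fun q : PhaseSpace N × PhaseSpace N => h q.2 ^ 2) (μ ⊗ₘ κ) := by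
    have hh2' : Integrable (fun y => h y ^ 2) ((μ ⊗ₘ κ).map Prod.snd) := by rw [hsnd]; exact hh2
    exact (integrable_map_measure hh2'.aestronglyMeasurable measurable_snd.aemeasurable).1 hh2'
  have hA' : ∫ q, f q.1 ^ 2 ∂(μ ⊗ₘ κ) = ∫ y, f y ^ 2 ∂μ := by
    have hf2' : AEStronglyMeasurable (fun y => f y ^ 2) ((μ ⊗ₘ κ).map Prod.fst) := by rw [hfst]; exact hf2.aestronglyMeasurable
    rw [← integral_map measurable_fst.aemeasurable hf2', hfst]
  have hB' : ∫ q, h q.2 ^ 2 ∂(μ ⊗ₘ κ) = ∫ y, h y ^ 2 ∂μ := by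
    have hh2' : AEStronglyMeasurable (fun y => h y ^ 2) ((μ ⊗ₘ κ).map Prod.snd) := by rw [hsnd]; exact hh2.aestronglyMeasurable
    rw [← integral_map measurable_snd.aemeasurable hh2', hsnd]
  calc ∫ y, ‖f y * ∫ y', h y' ∂κ y‖ ∂μ
      ≤ ∫ y, ∫ y', ‖f y * h y'‖ ∂κ y ∂μ := integral_mono hint.norm h2 hptw
    _ = ∫ q, ‖f q.1 * h q.2‖ ∂(μ ⊗ₘ κ) := (Measure.integral_compProd hce.norm).symm
    _ ≤ ∫ q, (f q.1 ^ 2 + h q.2 ^ 2) ∂(μ ⊗ₘ κ) := by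
        refine integral_mono hce.norm (hA.add hB) fun q => ?_
        simpa [Real.norm_eq_abs] using abs_mul_le_sq_add_sq (f q.1) (h q.2)
    _ = (∫ y, f y ^ 2 ∂μ) + ∫ y, h y ^ 2 ∂μ := by rw [integral_add hA hB, hA', hB']

omit hω hl hβ hγ in
/-- `y ↦ f(y) h(y)` is `μ`-integrable for `f, h ∈ L²(μ)`. [folklore] -/
theorem integrable_mul_of_sq {μ : Measure (PhaseSpace N)} {f h : PhaseSpace N → ℝ} (hf : Measurable f)
    (hh : Measurable h) (hf2 : Integrable (fun y => f y ^ 2) μ) (hh2 : Integrable (fun y => h y ^ 2) μ) :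
    Integrable (fun y => f y * h y) μ := by
  refine (hf2.add hh2).mono' (hf.mul hh).aestronglyMeasurable (Eventually.of_forall fun y => ?_)
  simpa [Real.norm_eq_abs] using abs_mul_le_sq_add_sq (f y) (h y)

/-- **Dynkin's identity integrated against an `L²` observable.** If the observable `e` satisfies
Dynkin's identity `P_r e(z) - e(z) = ∫₀ʳ P_s ℓ(z) ds` pointwise for the constructed kernels (with
`ℓ = L e`; for `e ∈ C_c^∞` this is `pinnedChain_dynkin`, for the polynomially growing bath-site energy
`e₀` it is a HYPOTHESIS here), then for every `f ∈ L²(μ)`, `μ` invariant, and `r ≥ 0`: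
`∫ f · (P_r e) dμ - ∫ f e dμ = ∫₀ʳ ∫ f · (P_s ℓ) dμ ds`. [folklore] -/
theorem pinnedChain_integral_mul_act_sub_of_dynkin (μ : Measure (PhaseSpace N)) [SFinite μ]
    (hinv : ∀ s : ℝ≥0, μ.bind ((pinnedChain ω₂ lam β γ).transitionKernel N T_L T_R s) = μ)
    {f e ℓ : PhaseSpace N → ℝ} (hf : Measurable f) (he : Measurable e) (hℓ : Measurable ℓ)
    (hf2 : Integrable (fun y => f y ^ 2) μ) (he2 : Integrable (fun y => e y ^ 2) μ)
    (hℓ2 : Integrable (fun y => ℓ y ^ 2) μ)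
    (hdyn : ∀ (r : ℝ≥0) (z : PhaseSpace N),
      ∫ y, e y ∂((pinnedChain ω₂ lam β γ).transitionKernel N T_L T_R r z) - e z =
        ∫ s in (0 : ℝ)..(r : ℝ), ∫ y, ℓ y ∂((pinnedChain ω₂ lam β γ).transitionKernel N T_L T_R s.toNNReal z))
    {r : ℝ} (hr : 0 ≤ r) :
    (∫ y, f y * (∫ y', e y' ∂((pinnedChain ω₂ lam β γ).transitionKernel N T_L T_R r.toNNReal y)) ∂μ) -
        ∫ y, f y * e y ∂μ =
      ∫ s in (0 : ℝ)..r,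
        ∫ y, f y * (∫ y', ℓ y' ∂((pinnedChain ω₂ lam β γ).transitionKernel N T_L T_R s.toNNReal y)) ∂μ := by
  haveI hLfin : IsFiniteMeasure ((volume : Measure ℝ).restrict (Ioc 0 r)) := by
    refine ⟨?_⟩
    rw [Measure.restrict_apply_univ]
    exact measure_Ioc_lt_top
  have hfe := integrable_mul_of_sq (N := N) hf he hf2 he2
  have hfPe := (pinnedChain_integrable_mul_act_of_invariant hω hl hβ hγ N T_L T_R μ r.toNNReal (hinv _) hf he hf2 he2).1
  -- pointwise Dynkin, multiplied by `f`
  have hpt : ∀ y, f y * (∫ y', e y' ∂((pinnedChain ω₂ lam β γ).transitionKernel N T_L T_R r.toNNReal y)) - f y * e y =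
      ∫ s in Ioc 0 r, f y * ∫ y', ℓ y' ∂((pinnedChain ω₂ lam β γ).transitionKernel N T_L T_R s.toNNReal y) := by
    intro y
    have h1 := hdyn r.toNNReal y
    rw [Real.coe_toNNReal r hr] at h1
    rw [← mul_sub, h1, integral_of_le hr, ← MeasureTheory.integral_const_mul]
  rw [← integral_sub hfPe hfe, integral_congr_ae (Eventually.of_forall hpt)]
  -- Fubini between `μ` and `(0, r]`
  -- the time-indexed kernel `(y, s) ↦ P_{s⁺}(y, ·)` as one kernel
  let Kq : Kernel (PhaseSpace N × ℝ) (PhaseSpace N) :=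
    { toFun := fun q => (pinnedChain ω₂ lam β γ).transitionKernel N T_L T_R q.2.toNNReal q.1
      measurable' := by
        have h1 : Measurable fun q : PhaseSpace N × ℝ => (q.2.toNNReal, q.1) :=
          (measurable_real_toNNReal.comp measurable_snd).prodMk measurable_fst
        have h2 := (pinnedChain_measurable_transitionKernel hω hl hβ hγ N T_L T_R).comp h1
        exact h2 }
  haveI : IsMarkovKernel Kq :=
    ⟨fun q => (pinnedChain_isMarkovKernel_transitionKernel hω hl hβ hγ N T_L T_R q.2.toNNReal).isProbabilityMeasure q.1⟩
  have hPl : StronglyMeasurable fun q : PhaseSpace N × ℝ =>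
      ∫ y', ℓ y' ∂((pinnedChain ω₂ lam β γ).transitionKernel N T_L T_R q.2.toNNReal q.1) :=
    StronglyMeasurable.integral_kernel_prod_right' (κ := Kq) (hℓ.comp measurable_snd).stronglyMeasurable
  have hFsm : StronglyMeasurable fun q : PhaseSpace N × ℝ =>
      f q.1 * ∫ y', ℓ y' ∂((pinnedChain ω₂ lam β γ).transitionKernel N T_L T_R q.2.toNNReal q.1) :=
    (hf.comp measurable_fst).stronglyMeasurable.mul hPl
  have hFi : Integrable (fun q : PhaseSpace N × ℝ =>
      f q.1 * ∫ y', ℓ y' ∂((pinnedChain ω₂ lam β γ).transitionKernel N T_L T_R q.2.toNNReal q.1))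
      (μ.prod ((volume : Measure ℝ).restrict (Ioc 0 r))) := by
    rw [integrable_prod_iff' hFsm.aestronglyMeasurable]
    refine ⟨Eventually.of_forall fun s => ?_, ?_⟩
    · exact (pinnedChain_integrable_mul_act_of_invariant hω hl hβ hγ N T_L T_R μ s.toNNReal (hinv _) hf hℓ hf2 hℓ2).1
    · refine Integrable.of_bound (hFsm.norm.integral_prod_left' (μ := μ)).aestronglyMeasurable
        ((∫ y, f y ^ 2 ∂μ) + ∫ y, ℓ y ^ 2 ∂μ) (Eventually.of_forall fun s => ?_)
      rw [Real.norm_eq_abs, abs_of_nonneg (integral_nonneg fun y => norm_nonneg _)]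
      exact (pinnedChain_integrable_mul_act_of_invariant hω hl hβ hγ N T_L T_R μ s.toNNReal (hinv _) hf hℓ hf2 hℓ2).2
  have hFi' : Integrable (Function.uncurry fun (y : PhaseSpace N) (s : ℝ) =>
      f y * ∫ y', ℓ y' ∂((pinnedChain ω₂ lam β γ).transitionKernel N T_L T_R s.toNNReal y))
      (μ.prod ((volume : Measure ℝ).restrict (Ioc 0 r))) := hFi
  rw [integral_integral_swap hFi', ← integral_of_le hr]

end Pairing

/-! ### The kernel pairing as a function of the (real) time: measurability and bound -/

section PairingTime

variable {ω₂ lam β γ : ℝ} (hω : 0 < ω₂) (hl : 0 ≤ lam) (hβ : 0 ≤ β) (hγ : 0 ≤ γ) (N : ℕ) (T_L T_R : ℝ)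
include hω hl hβ hγ

/-- `u ↦ ∫ f · (P_{u⁺} h) dμ` is measurable on `ℝ` (`f, h` measurable, `μ` s-finite). [folklore] -/
theorem pinnedChain_measurable_kernelPairing (μ : Measure (PhaseSpace N)) [SFinite μ]
    {f h : PhaseSpace N → ℝ} (hf : Measurable f) (hh : Measurable h) :
    Measurable fun u : ℝ =>
      ∫ y, f y * (∫ y', h y' ∂((pinnedChain ω₂ lam β γ).transitionKernel N T_L T_R u.toNNReal y)) ∂μ := by
  let Kq : Kernel (ℝ × PhaseSpace N) (PhaseSpace N) :=
    { toFun := fun q => (pinnedChain ω₂ lam β γ).transitionKernel N T_L T_R q.1.toNNReal q.2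
      measurable' := by
        have h1 : Measurable fun q : ℝ × PhaseSpace N => (q.1.toNNReal, q.2) :=
          (measurable_real_toNNReal.comp measurable_fst).prodMk measurable_snd
        have h2 := (pinnedChain_measurable_transitionKernel hω hl hβ hγ N T_L T_R).comp h1
        exact h2 }
  haveI : IsMarkovKernel Kq :=
    ⟨fun q => (pinnedChain_isMarkovKernel_transitionKernel hω hl hβ hγ N T_L T_R q.1.toNNReal).isProbabilityMeasure q.2⟩
  have hPl : StronglyMeasurable fun q : ℝ × PhaseSpace N =>
      ∫ y', h y' ∂((pinnedChain ω₂ lam β γ).transitionKernel N T_L T_R q.1.toNNReal q.2) :=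
    StronglyMeasurable.integral_kernel_prod_right' (κ := Kq) (hh.comp measurable_snd).stronglyMeasurable
  have hFsm : StronglyMeasurable fun q : ℝ × PhaseSpace N =>
      f q.2 * ∫ y', h y' ∂((pinnedChain ω₂ lam β γ).transitionKernel N T_L T_R q.1.toNNReal q.2) :=
    (hf.comp measurable_snd).stronglyMeasurable.mul hPl
  exact (hFsm.integral_prod_right' (ν := μ)).measurable

/-- `|∫ f · (P_{u⁺} h) dμ| ≤ ∫ f² dμ + ∫ h² dμ` for every real `u`, under an invariant law. [folklore] -/
theorem pinnedChain_abs_kernelPairing_le (μ : Measure (PhaseSpace N)) [SFinite μ]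
    (hinv : ∀ s : ℝ≥0, μ.bind ((pinnedChain ω₂ lam β γ).transitionKernel N T_L T_R s) = μ)
    {f h : PhaseSpace N → ℝ} (hf : Measurable f) (hh : Measurable h)
    (hf2 : Integrable (fun y => f y ^ 2) μ) (hh2 : Integrable (fun y => h y ^ 2) μ) (u : ℝ) :
    |∫ y, f y * (∫ y', h y' ∂((pinnedChain ω₂ lam β γ).transitionKernel N T_L T_R u.toNNReal y)) ∂μ| ≤
      (∫ y, f y ^ 2 ∂μ) + ∫ y, h y ^ 2 ∂μ := by
  have h1 := pinnedChain_integrable_mul_act_of_invariant hω hl hβ hγ N T_L T_R μ u.toNNReal (hinv _) hf hh hf2 hh2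
  rw [← Real.norm_eq_abs]
  exact (MeasureTheory.norm_integral_le_integral_norm _).trans h1.2

/-- The kernel pairing is interval integrable on every interval. [folklore] -/
theorem pinnedChain_intervalIntegrable_kernelPairing (μ : Measure (PhaseSpace N)) [SFinite μ]
    (hinv : ∀ s : ℝ≥0, μ.bind ((pinnedChain ω₂ lam β γ).transitionKernel N T_L T_R s) = μ)
    {f h : PhaseSpace N → ℝ} (hf : Measurable f) (hh : Measurable h)
    (hf2 : Integrable (fun y => f y ^ 2) μ) (hh2 : Integrable (fun y => h y ^ 2) μ) (a b : ℝ) :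
    IntervalIntegrable (fun u : ℝ =>
      ∫ y, f y * (∫ y', h y' ∂((pinnedChain ω₂ lam β γ).transitionKernel N T_L T_R u.toNNReal y)) ∂μ) volume a b :=
  intervalIntegrable_of_bounded_measurable (pinnedChain_measurable_kernelPairing hω hl hβ hγ N T_L T_R μ hf hh)
    (pinnedChain_abs_kernelPairing_le hω hl hβ hγ N T_L T_R μ hinv hf hh hf2 hh2) a b

end PairingTime

/-! ### Statics: square-integrability of the bath-site observables under the Gibbs measure -/

section Statics

variable {ω₂ lam β : ℝ} (hω : 0 < ω₂) (hl : 0 ≤ lam) (hβ : 0 ≤ β) (γ : ℝ) (N : ℕ) {T : ℝ} (hT : 0 < T)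
include hω hl hβ hT

/-- `(1 + H)⁴ ∈ L¹(μ_T)` for the Gibbs measure of the pinned chain (`ω₂ > 0`, `lam, β ≥ 0`, `T > 0`):
polynomial moments from the exponential moment `e^{ϑH} ∈ L¹(μ_T)`, `ϑ = 1/(2T)`. [folklore] -/
theorem pinnedChain_integrable_one_add_hamiltonian_pow_four :
    Integrable (fun y => (1 + (pinnedChain ω₂ lam β γ).hamiltonian N y) ^ 4)
      ((pinnedChain ω₂ lam β γ).gibbsMeasure N T) := by
  set ϑ : ℝ := 1 / (2 * T) with hϑ
  have hϑ0 : 0 < ϑ := by rw [hϑ]; positivity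
  have hϑ1 : ϑ < 1 / T := by
    rw [hϑ, div_lt_div_iff₀ (by positivity) hT]
    nlinarith
  have hexp := pinnedChain_integrable_exp_mul_hamiltonian_gibbsMeasure hω hl hβ γ N hT hϑ1
  have hHc : Continuous ((pinnedChain ω₂ lam β γ).hamiltonian N) := pinnedChain_continuous_hamiltonian ω₂ lam β γ N
  set C : ℝ := 24 * Real.exp ϑ / ϑ ^ 4 with hC
  refine (hexp.const_mul C).mono' ((continuous_const.add hHc).pow 4).aestronglyMeasurable
    (Eventually.of_forall fun y => ?_)
  have hH0 : 0 ≤ (pinnedChain ω₂ lam β γ).hamiltonian N y := pinnedChain_hamiltonian_nonneg hω.le hl hβ γ N y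
  set H := (pinnedChain ω₂ lam β γ).hamiltonian N y with hHdef
  have hx : 0 ≤ ϑ * (1 + H) := by positivity
  have key := Real.pow_div_factorial_le_exp _ hx 4
  have h24 : ((4 : ℕ).factorial : ℝ) = 24 := by norm_num [Nat.factorial]
  rw [h24, mul_add, mul_one, Real.exp_add, div_le_iff₀ (by norm_num : (0 : ℝ) < 24)] at key
  -- `key : (ϑ + ϑ H)^4 ≤ e^ϑ e^{ϑH} · 24`
  rw [Real.norm_eq_abs, abs_of_nonneg (by positivity), hC]
  have hϑ4 : 0 < ϑ ^ 4 := by positivity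
  rw [div_mul_eq_mul_div, le_div_iff₀ hϑ4]
  calc (1 + H) ^ 4 * ϑ ^ 4 = (ϑ + ϑ * H) ^ 4 := by ring
    _ ≤ Real.exp ϑ * Real.exp (ϑ * H) * 24 := key
    _ = 24 * Real.exp ϑ * Real.exp (ϑ * H) := by ring

/-- A continuous observable dominated by `C (1 + H)²` in absolute value is square-integrable under
`μ_T`. [folklore] -/
theorem pinnedChain_integrable_sq_of_abs_le {f : PhaseSpace N → ℝ} (hf : Continuous f) {C : ℝ}
    (hfC : ∀ y, |f y| ≤ C * (1 + (pinnedChain ω₂ lam β γ).hamiltonian N y) ^ 2) :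
    Integrable (fun y => f y ^ 2) ((pinnedChain ω₂ lam β γ).gibbsMeasure N T) := by
  have h4 := pinnedChain_integrable_one_add_hamiltonian_pow_four hω hl hβ γ N hT
  refine (h4.const_mul (C ^ 2)).mono' (hf.pow 2).aestronglyMeasurable (Eventually.of_forall fun y => ?_)
  have hH0 : 0 ≤ (pinnedChain ω₂ lam β γ).hamiltonian N y := pinnedChain_hamiltonian_nonneg hω.le hl hβ γ N y
  rw [Real.norm_eq_abs, abs_of_nonneg (sq_nonneg _)]
  have h1 : f y ^ 2 = |f y| ^ 2 := (sq_abs _).symm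
  rw [h1]
  calc |f y| ^ 2 ≤ (C * (1 + (pinnedChain ω₂ lam β γ).hamiltonian N y) ^ 2) ^ 2 :=
        pow_le_pow_left₀ (abs_nonneg _) (hfC y) 2
    _ = C ^ 2 * (1 + (pinnedChain ω₂ lam β γ).hamiltonian N y) ^ 4 := by ring

/-- The bond currents are square-integrable under `μ_T`. [folklore] -/
theorem pinnedChain_integrable_sq_bondCurrent (i : Fin N) :
    Integrable (fun y => (pinnedChain ω₂ lam β γ).bondCurrent N i y ^ 2) ((pinnedChain ω₂ lam β γ).gibbsMeasure N T) :=
  pinnedChain_integrable_sq_of_abs_le hω hl hβ γ N hT (pinnedChain_continuous_bondCurrent ω₂ lam β γ N i)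
    (C := (N : ℝ) * ((3 + β) / 2)) fun y => by
      have h := pinnedChain_abs_bondCurrent_le hω.le hl hβ γ N i y
      calc |(pinnedChain ω₂ lam β γ).bondCurrent N i y|
          ≤ N * ((3 + β) / 2 * (1 + (pinnedChain ω₂ lam β γ).hamiltonian N y) ^ 2) := h
        _ = (N : ℝ) * ((3 + β) / 2) * (1 + (pinnedChain ω₂ lam β γ).hamiltonian N y) ^ 2 := by ring

/-- The kinetic-temperature deviation `γ'(T' - p_i²)` is square-integrable under `μ_T`. [folklore] -/
theorem pinnedChain_integrable_sq_kineticDeviation (γ' T' : ℝ) (i : Fin N) :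
    Integrable (fun y : PhaseSpace N => (γ' * (T' - (y.2 i) ^ 2)) ^ 2) ((pinnedChain ω₂ lam β γ).gibbsMeasure N T) := by
  refine pinnedChain_integrable_sq_of_abs_le hω hl hβ γ N hT (by fun_prop) (C := |γ'| * (|T'| + 2)) fun y => ?_
  have hH0 : 0 ≤ (pinnedChain ω₂ lam β γ).hamiltonian N y := pinnedChain_hamiltonian_nonneg hω.le hl hβ γ N y
  have hU0 : ∀ q, 0 ≤ (pinnedChain ω₂ lam β γ).U q := fun q => by
    show 0 ≤ ω₂ * q ^ 2 / 2 + lam * q ^ 4 / 4; positivity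
  have hV0 : ∀ r, 0 ≤ (pinnedChain ω₂ lam β γ).V r := fun r => by
    show 0 ≤ r ^ 2 / 2 + β * r ^ 4 / 4; positivity
  have hsite := (pinnedChain ω₂ lam β γ).site_le_hamiltonian hU0 hV0 N y i
  have hp : (y.2 i) ^ 2 ≤ 2 * (pinnedChain ω₂ lam β γ).hamiltonian N y := by linarith [hU0 (y.1 i)]
  set H := (pinnedChain ω₂ lam β γ).hamiltonian N y
  rw [abs_mul, mul_assoc]
  refine mul_le_mul_of_nonneg_left ?_ (abs_nonneg _)
  calc |T' - (y.2 i) ^ 2| ≤ |T'| + |(y.2 i) ^ 2| := abs_sub _ _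
    _ = |T'| + (y.2 i) ^ 2 := by rw [abs_of_nonneg (sq_nonneg (y.2 i))]
    _ ≤ |T'| + 2 * H := by linarith
    _ ≤ (|T'| + 2) * (1 + H) ^ 2 := by
        nlinarith [abs_nonneg T', hH0, sq_nonneg H, mul_nonneg (abs_nonneg T') hH0,
          mul_nonneg (abs_nonneg T') (sq_nonneg H)]

/-- The bath-site energy `e₀ = p₀²/2 + U(q₀) + ½V(q₁ - q₀)` is square-integrable under `μ_T` (`N ≥ 2`).
[folklore] -/
theorem pinnedChain_integrable_sq_siteEnergy (hN : 1 < N) :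
    Integrable (fun y : PhaseSpace N => ((y.2 ⟨0, Nat.zero_lt_of_lt hN⟩) ^ 2 / 2 +
        (pinnedChain ω₂ lam β γ).U (y.1 ⟨0, Nat.zero_lt_of_lt hN⟩) +
        (pinnedChain ω₂ lam β γ).V (y.1 ⟨1, hN⟩ - y.1 ⟨0, Nat.zero_lt_of_lt hN⟩) / 2) ^ 2)
      ((pinnedChain ω₂ lam β γ).gibbsMeasure N T) := by
  have hUc : Continuous (pinnedChain ω₂ lam β γ).U := (pinnedChain_contDiff_U ω₂ lam β γ (n := 0)).continuous
  have hVc : Continuous (pinnedChain ω₂ lam β γ).V := (pinnedChain_contDiff_V ω₂ lam β γ (n := 0)).continuous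
  have hc : Continuous fun y : PhaseSpace N => (y.2 ⟨0, Nat.zero_lt_of_lt hN⟩) ^ 2 / 2 +
      (pinnedChain ω₂ lam β γ).U (y.1 ⟨0, Nat.zero_lt_of_lt hN⟩) +
      (pinnedChain ω₂ lam β γ).V (y.1 ⟨1, hN⟩ - y.1 ⟨0, Nat.zero_lt_of_lt hN⟩) / 2 := by
    have h1 : Continuous fun y : PhaseSpace N => y.2 ⟨0, Nat.zero_lt_of_lt hN⟩ := by fun_prop
    have h2 : Continuous fun y : PhaseSpace N => y.1 ⟨0, Nat.zero_lt_of_lt hN⟩ := by fun_prop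
    have h3 : Continuous fun y : PhaseSpace N => y.1 ⟨1, hN⟩ := by fun_prop
    exact (((h1.pow 2).div_const 2).add (hUc.comp h2)).add ((hVc.comp (h3.sub h2)).div_const 2)
  refine pinnedChain_integrable_sq_of_abs_le hω hl hβ γ N hT hc (C := 3 / 2) fun y => ?_
  have hH0 : 0 ≤ (pinnedChain ω₂ lam β γ).hamiltonian N y := pinnedChain_hamiltonian_nonneg hω.le hl hβ γ N y
  have hU0 : ∀ q, 0 ≤ (pinnedChain ω₂ lam β γ).U q := fun q => by
    show 0 ≤ ω₂ * q ^ 2 / 2 + lam * q ^ 4 / 4; positivity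
  have hV0 : ∀ r, 0 ≤ (pinnedChain ω₂ lam β γ).V r := fun r => by
    show 0 ≤ r ^ 2 / 2 + β * r ^ 4 / 4; positivity
  have hsite := (pinnedChain ω₂ lam β γ).site_le_hamiltonian hU0 hV0 N y ⟨0, Nat.zero_lt_of_lt hN⟩
  have hbond := (pinnedChain ω₂ lam β γ).bond_le_hamiltonian hU0 hV0 N y
    (k := ⟨0, Nat.zero_lt_of_lt hN⟩) (l := ⟨1, hN⟩) rfl
  set H := (pinnedChain ω₂ lam β γ).hamiltonian N y
  have hnn : 0 ≤ (y.2 ⟨0, Nat.zero_lt_of_lt hN⟩) ^ 2 / 2 + (pinnedChain ω₂ lam β γ).U (y.1 ⟨0, Nat.zero_lt_of_lt hN⟩) +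
      (pinnedChain ω₂ lam β γ).V (y.1 ⟨1, hN⟩ - y.1 ⟨0, Nat.zero_lt_of_lt hN⟩) / 2 := by
    have := hU0 (y.1 ⟨0, Nat.zero_lt_of_lt hN⟩)
    have := hV0 (y.1 ⟨1, hN⟩ - y.1 ⟨0, Nat.zero_lt_of_lt hN⟩)
    positivity
  rw [abs_of_nonneg hnn]
  have hV1 := hV0 (y.1 ⟨1, hN⟩ - y.1 ⟨0, Nat.zero_lt_of_lt hN⟩)
  nlinarith [hsite, hbond, hH0, hV1]

end Statics

/-- **Dynkin's identity integrated against an `L²` observable** (registered sub-goal of `stub_bathBondReduction`;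
closed form of `pinnedChain_integral_mul_act_sub_of_dynkin`): for the pinned chain (`ω₂ > 0`, `lam, β, γ ≥ 0`), an
s-finite law `μ` invariant for the constructed kernels, observables `f, e, ℓ` measurable with squares in `L¹(μ)`,
if `P_r e(z) - e(z) = ∫₀ʳ P_s ℓ(z) ds` for all `r ≥ 0` and all `z`, then for `r ≥ 0`:
`∫ f · (P_r e) dμ - ∫ f e dμ = ∫₀ʳ ∫ f · (P_s ℓ) dμ ds`. [folklore] -/
theorem pinnedChain_dynkinIntegrated :
    ∀ (ω₂ lam β γ : ℝ), 0 < ω₂ → 0 ≤ lam → 0 ≤ β → 0 ≤ γ → ∀ (N : ℕ) (T_L T_R : ℝ)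
      (μ : MeasureTheory.Measure (PhaseSpace N)) [MeasureTheory.SFinite μ],
      (∀ s : NNReal, μ.bind ((pinnedChain ω₂ lam β γ).transitionKernel N T_L T_R s) = μ) →
      ∀ (f e ℓ : PhaseSpace N → ℝ), Measurable f → Measurable e → Measurable ℓ →
      MeasureTheory.Integrable (fun y => f y ^ 2) μ → MeasureTheory.Integrable (fun y => e y ^ 2) μ →
      MeasureTheory.Integrable (fun y => ℓ y ^ 2) μ →
      (∀ (r : NNReal) (z : PhaseSpace N),
        ∫ y, e y ∂((pinnedChain ω₂ lam β γ).transitionKernel N T_L T_R r z) - e z =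
          ∫ s in (0 : ℝ)..(r : ℝ), ∫ y, ℓ y ∂((pinnedChain ω₂ lam β γ).transitionKernel N T_L T_R s.toNNReal z)) →
      ∀ r : ℝ, 0 ≤ r →
        (∫ y, f y * (∫ y', e y' ∂((pinnedChain ω₂ lam β γ).transitionKernel N T_L T_R r.toNNReal y)) ∂μ) -
            ∫ y, f y * e y ∂μ =
          ∫ s in (0 : ℝ)..r,
            ∫ y, f y * (∫ y', ℓ y' ∂((pinnedChain ω₂ lam β γ).transitionKernel N T_L T_R s.toNNReal y)) ∂μ := by
  intro ω₂ lam β γ hω hl hβ hγ N T_L T_R μ _ hinv f e ℓ hf he hℓ hf2 he2 hℓ2 hdyn r hr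
  exact pinnedChain_integral_mul_act_sub_of_dynkin hω hl hβ hγ N T_L T_R μ hinv hf he hℓ hf2 he2 hℓ2 hdyn hr

end Summit.AtomisticToContinuum.FouriersLaw.Theorems.SubdiffusiveBondHeat
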